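import Literature.MathematicalPhysics.QuantumFieldTheory.Balaban1983to89.B9Thm39WholeBlkVia
import Literature.MathematicalPhysics.QuantumFieldTheory.Balaban1983to89.Node00.OpsYDeltaA

/-!
# `Balaban1983to89.B9Thm39ReadingCoords` — real coordinates of `𝔤`-valued block functions and the representative bonds of the geometry of
# record: the two dictionaries behind the DISCHARGE of rows 15–16's carrier-kernel reading at def-Y's letters (`B9Thm39ReadingAtLetters`)

T. Bałaban, *Propagators for lattice gauge theories in a background field*, Commun. Math. Phys. **99** (1985) 389–434
[`Balaban1985BackgroundPropagators`, "B9"]; [4] = T. Bałaban, *Propagators and renormalization transformations for lattice gauge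
theories. II*, Commun. Math. Phys. **96** (1984) 223–250 [`Balaban1984PropagatorsII`].

statement-level skeleton of published theorems with citation tags; proofs where landed; nothing here is a claim about the
Yang–Mills mass gap

THE PRINTED LOCI (verbatim).  [B9] p. 389: *"If we write U(x, x′) = exp iηA(x, x′), where A is a function defined on bonds, with values in the Lie
algebra 𝔤 of the group G"*;  p. 399, Theorem 3.3: *"… λ replaced by a function J defined at bonds of the lattice T_η or Ω₀, and with values in 𝔤"*;
p. 398, Theorem 3.2: *"|(Q′(U)G′²(U)Q′\*(U))⁻¹(y, y′)| ≦ B₀(L^jη)^{−4}(L^{j′}η)^{−d}e^{−δ₀d(y,y′)}, y, y′ ∈ 𝔅"* (3.48);  [4] p. 224, (2.3): *"Λ_j =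
Ω_j^{(j)} ∖ Ω_{j+1}^{(j)} … we denote by Ω also the set of bonds ⋃_{x∈Ω} st(x)"*;  [4] p. 231: *"𝔅 = ⋃_j Λ_j"* (2.45), *"d(x, x′) = d(y, y′) if x ∈ B^j(y),
x′ ∈ B^{j′}(y′)"*;  [4] p. 248: *"We consider these operators on the L²-space defined by (2.69) with sites replaced by bonds"*.

WHY THIS FILE.  The N06 knit reads [B9]'s (3.48) kernel at def-Y's letter `C(U)` (`Node00.OpsYDeltaA.CY`) as `sup_{|E| ≤ 1} ‖(C(U)(δ_{β c′} ⊗ E))(β c)‖`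
over the INDEX BONDS `c, c′` of [4] (2.3) through the carrier-block map `β` (`B6Ineq2142KLevelV1.β`), while rows 15–16 (Theorem 3.9 ⇒ Theorem 3.2,
`B9Thm39WholeBlk` ∕ `…Faces` ∕ `…Via`) bound a carrier kernel by the BLOCK NORM `blockKer` of the inverse of L(U) = (Q′G′²Q′\*)(U) acting on REAL
functions on a carrier `X` fibred over the geometry's sites.  To make the reading a THEOREM at the genuine letter one needs (i) the identification of
`𝔸`-valued block functions (`𝔸 = M_N(ℂ) ⊃ 𝔤`) with real functions on `𝔅_blocks × (real coordinates of 𝔸)` and the comparison of an `𝔸`-valued kernel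
entry's norm with the coordinate block sum, and (ii) one REPRESENTATIVE index bond per carrier block (`β` is many-to-one), with the geometry's `dist`
and `len` invariant under the representative map (they factor through `β`: `kGeo.dist c c′ = d_T(β c, β c′)`, `kGeo.scale c = j(β c)`).  THIS FILE
supplies exactly these two dictionaries; the sibling `B9Thm39ReadingAtLetters` assembles the discharge.

* §1 `coordEquiv39 b : (S × κ → ℝ) ≃ₗ[ℝ] (S → 𝔸)` (a real basis `b` of `𝔸`), `realify39 b O : Module.End ℝ (S × κ → ℝ)` (a ℂ-linear operator on
  `𝔸`-valued functions in real coordinates; `realify39_mul`, `realify39_one`, `realify39_injective`), `entry_realify39` (the matrix entry of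
  `realify39 b O` IS a coordinate of the kernel entry `(O(δ_{s′} ⊗ b_{c′}))(s)`), the constants `coordBound39`, `basisBound39`, ★ `cR39 b`, and
  ★ `norm_apply_deltaY_le`: `‖(O(δ_{s′} ⊗ E))(s)‖ ≦ coordBound · basisBound · Σ_c Σ_{c′} |entry (realify39 b O) (s, c) (s′, c′)|` for `‖E‖ ≦ 1`.
* §2 `bondIdx_nonempty` (every `Domains` datum has an index bond: the top non-empty level), `rep39` ∕ `repSite39` (the representative bond of a
  block ∕ of a bond's carrier block), `beta_rep39`, `beta_repSite39`, ★ `dist_repSite39` (+ `_left` ∕ `_right`), `lvl_repSite39`, ★ `len_repSite39`, `vol_repSite39`.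

HONEST SCOPE.  Finite-dimensional linear algebra and the record's index combinatorics; nothing of [B9] or [4] is asserted; blocks outside the range of
`β` (inner corners — `B9BetaRangeKLevelV1`) get an arbitrary representative (harmless for the reading, which only uses `β ∘ rep ∘ β = β`).  Bookkeeping —
NOT a node discharge, NOT summit progress; count-neutral; one finite 𝕋⁴ programme — nothing continuum, nothing about the mass gap.  Cell `pub-ymgap`
(HUMAN RULING D-0062), Track A node N06 [B9], seat `pub-ymgap-dag-n06-j` (harness re-seat gen 5), 2026-08-27.
-/

namespace Literature.MathematicalPhysics.QuantumFieldTheory.Balaban1983to89.B9Thm39ReadingCoords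

open Literature.MathematicalPhysics.QuantumFieldTheory.Balaban1983to89
open Finset B9Thm34Inv B9Thm39WholeBlk Node00

noncomputable section

/-! ## §1 Real coordinates of `𝔸`-valued functions on a finite set, from a real basis of `𝔸` -/

section Coords

variable {𝔸 : Type} [NormedRing 𝔸] [NormedAlgebra ℂ 𝔸]
variable {S κ : Type} [Fintype κ]

/-- real coordinates of an `𝔸`-valued function on `S` in the basis `b`: `f ↦ (s ↦ Σ_c f(s, c) • b_c)`, an ℝ-linear equivalence
`(S × κ → ℝ) ≃ (S → 𝔸)`. [cite: Balaban1985BackgroundPropagators, p.389 ((3.2): «A with values in the Lie algebra 𝔤»), dictionary] -/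
def coordEquiv39 (b : Module.Basis κ ℝ 𝔸) : (S × κ → ℝ) ≃ₗ[ℝ] (S → 𝔸) where
  toFun f := fun s => ∑ c, f (s, c) • b c
  invFun g := fun p => b.repr (g p.1) p.2
  map_add' f f' := by
    funext s
    simp only [Pi.add_apply, add_smul, Finset.sum_add_distrib]
  map_smul' r f := by
    funext s
    simp only [Pi.smul_apply, smul_eq_mul, RingHom.id_apply, Finset.smul_sum, smul_smul]
  left_inv f := by
    funext p
    obtain ⟨s, c⟩ := p
    simp only
    rw [← b.equivFun_symm_apply, ← b.equivFun_apply, LinearEquiv.apply_symm_apply]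
  right_inv g := by
    funext s
    exact b.sum_repr (g s)

/-- the coordinate map, evaluated. [cite: Balaban1985BackgroundPropagators, p.389, dictionary] -/
theorem coordEquiv39_apply (b : Module.Basis κ ℝ 𝔸) (f : S × κ → ℝ) (s : S) : coordEquiv39 b f s = ∑ c, f (s, c) • b c := rfl

/-- the inverse coordinate map, evaluated. [cite: Balaban1985BackgroundPropagators, p.389, dictionary] -/
theorem coordEquiv39_symm_apply (b : Module.Basis κ ℝ 𝔸) (g : S → 𝔸) (p : S × κ) : (coordEquiv39 b).symm g p = b.repr (g p.1) p.2 := rfl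

/-- the coordinate vector `δ_{(s′, c′)}` is the 𝔸-valued delta function `δ_{s′} ⊗ b_{c′}`. [cite: Balaban1985BackgroundPropagators, (3.48) p.398 (kernels), dictionary] -/
theorem coordEquiv39_single [DecidableEq S] [DecidableEq κ] (b : Module.Basis κ ℝ 𝔸) (s' : S) (c' : κ) :
    coordEquiv39 b (Pi.single (M := fun _ : S × κ => ℝ) (s', c') 1) = deltaY s' (b c') := by
  funext s
  rw [coordEquiv39_apply]
  by_cases hs : s = s'
  · subst hs
    rw [Finset.sum_eq_single c']
    · simp [deltaY]
    · intro c _ hc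
      rw [Pi.single_eq_of_ne (by simpa using hc), zero_smul]
    · intro h; exact absurd (Finset.mem_univ _) h
  · have h0 : ∀ c, Pi.single (M := fun _ : S × κ => ℝ) (s', c') 1 (s, c) = 0 := fun c =>
      Pi.single_eq_of_ne (by simpa using fun h _ => hs h) _
    simp only [h0, zero_smul, Finset.sum_const_zero, deltaY, if_neg hs]

/-- ★ **A ℂ-LINEAR OPERATOR ON `𝔸`-VALUED FUNCTIONS, IN REAL COORDINATES**: `realify39 b O := (coordinates)⁻¹ ∘ O ∘ (coordinates)`, an ℝ-linear
endomorphism of `S × κ → ℝ` — the carrier on which [4]'s (2.51) block-majorant calculus (`B6RandomWalk.HasMajorant`, `B9Thm39WholeBlk.blockKer`) is typed.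
[cite: Balaban1985BackgroundPropagators, p.389 + (3.48) p.398; Balaban1984PropagatorsII, (2.51) p.232, dictionary] -/
def realify39 (b : Module.Basis κ ℝ 𝔸) (O : (S → 𝔸) →ₗ[ℂ] (S → 𝔸)) : Module.End ℝ (S × κ → ℝ) :=
  (coordEquiv39 b).symm.toLinearMap ∘ₗ O.restrictScalars ℝ ∘ₗ (coordEquiv39 b).toLinearMap

/-- `realify39`, evaluated. [cite: Balaban1985BackgroundPropagators, p.389, dictionary] -/
theorem realify39_apply (b : Module.Basis κ ℝ 𝔸) (O : (S → 𝔸) →ₗ[ℂ] (S → 𝔸)) (f : S × κ → ℝ) :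
    realify39 b O f = (coordEquiv39 b).symm (O (coordEquiv39 b f)) := rfl

/-- `realify39` is multiplicative. [cite: Balaban1985BackgroundPropagators, p.389, dictionary] -/
theorem realify39_mul (b : Module.Basis κ ℝ 𝔸) (O O' : (S → 𝔸) →ₗ[ℂ] (S → 𝔸)) :
    realify39 b (O * O') = realify39 b O * realify39 b O' := by
  apply LinearMap.ext; intro f
  simp only [Module.End.mul_apply, realify39_apply, LinearEquiv.apply_symm_apply]

/-- `realify39 1 = 1`. [cite: Balaban1985BackgroundPropagators, p.389, dictionary] -/
theorem realify39_one (b : Module.Basis κ ℝ 𝔸) : realify39 b (1 : (S → 𝔸) →ₗ[ℂ] (S → 𝔸)) = 1 := by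
  apply LinearMap.ext; intro f
  simp only [Module.End.one_apply, realify39_apply, LinearEquiv.symm_apply_apply]

/-- `realify39` is injective (conjugation by an equivalence). [cite: Balaban1985BackgroundPropagators, p.389, dictionary] -/
theorem realify39_injective (b : Module.Basis κ ℝ 𝔸) : Function.Injective (realify39 (S := S) b) := by
  intro O O' h
  apply LinearMap.ext; intro g
  have := LinearMap.congr_fun h ((coordEquiv39 b).symm g)
  simp only [realify39_apply, LinearEquiv.apply_symm_apply] at this
  exact (coordEquiv39 b).symm.injective this

/-- **the matrix entry of the real-coordinate operator IS a coordinate of the `𝔸`-valued kernel entry**: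
`entry (realify39 b O) (s, c) (s′, c′) = (b-coordinate c of (O(δ_{s′} ⊗ b_{c′}))(s))`. [cite: Balaban1985BackgroundPropagators, (3.48) p.398 (kernel entries as values on delta functions), dictionary] -/
theorem entry_realify39 [DecidableEq S] [DecidableEq κ] (b : Module.Basis κ ℝ 𝔸) (O : (S → 𝔸) →ₗ[ℂ] (S → 𝔸)) (s : S) (c : κ) (s' : S) (c' : κ) :
    entry (realify39 b O) (s, c) (s', c') = b.repr (O (deltaY s' (b c')) s) c := by
  rw [entry, realify39_apply, coordEquiv39_single, coordEquiv39_symm_apply]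

/-- the kernel entry `(O(δ_{s′} ⊗ b_{c′}))(s)` resolved in the basis: `Σ_c entry(s, c; s′, c′) • b_c`. [cite: Balaban1985BackgroundPropagators, (3.48) p.398, dictionary] -/
theorem apply_deltaY_basis_eq_sum [DecidableEq S] [DecidableEq κ] (b : Module.Basis κ ℝ 𝔸) (O : (S → 𝔸) →ₗ[ℂ] (S → 𝔸)) (s s' : S) (c' : κ) :
    O (deltaY s' (b c')) s = ∑ c, entry (realify39 b O) (s, c) (s', c') • b c := by
  simp only [entry_realify39]
  exact (b.sum_repr _).symm

/-- the coordinate bound of the basis: `‖coordinates‖_op` (finite dimension). [cite: Balaban1985BackgroundPropagators, p.389, dictionary] -/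
def coordBound39 [FiniteDimensional ℝ 𝔸] (b : Module.Basis κ ℝ 𝔸) : ℝ := ‖LinearMap.toContinuousLinearMap b.equivFun.toLinearMap‖

/-- the size of the basis: `Σ_c ‖b_c‖`. [cite: Balaban1985BackgroundPropagators, p.389, dictionary] -/
def basisBound39 (b : Module.Basis κ ℝ 𝔸) : ℝ := ∑ c, ‖b c‖

/-- `|coordinate_c(E)| ≤ coordBound · ‖E‖`. [cite: Balaban1985BackgroundPropagators, p.389, dictionary] -/
theorem abs_repr_le [FiniteDimensional ℝ 𝔸] (b : Module.Basis κ ℝ 𝔸) (E : 𝔸) (c : κ) : |b.repr E c| ≤ coordBound39 b * ‖E‖ := by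
  have h1 : |b.repr E c| ≤ ‖(b.equivFun E : κ → ℝ)‖ := by
    rw [← Real.norm_eq_abs, ← b.equivFun_apply]
    exact norm_le_pi_norm _ c
  have h2 : ‖(b.equivFun E : κ → ℝ)‖ ≤ coordBound39 b * ‖E‖ := by
    have := (LinearMap.toContinuousLinearMap b.equivFun.toLinearMap).le_opNorm E
    simpa [coordBound39] using this
  exact h1.trans h2

/-- `‖Σ_c a_c • b_c‖ ≤ basisBound · Σ_c |a_c|`. [cite: Balaban1985BackgroundPropagators, p.389, dictionary] -/
theorem norm_sum_smul_basis_le (b : Module.Basis κ ℝ 𝔸) (a : κ → ℝ) : ‖∑ c, a c • b c‖ ≤ basisBound39 b * ∑ c, |a c| := by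
  calc ‖∑ c, a c • b c‖ ≤ ∑ c, ‖a c • b c‖ := norm_sum_le _ _
    _ = ∑ c, |a c| * ‖b c‖ := by simp [norm_smul]
    _ ≤ ∑ c, |a c| * basisBound39 b := by
        refine Finset.sum_le_sum fun c _ => mul_le_mul_of_nonneg_left ?_ (abs_nonneg _)
        exact Finset.single_le_sum (f := fun c => ‖b c‖) (fun _ _ => norm_nonneg _) (Finset.mem_univ c)
    _ = basisBound39 b * ∑ c, |a c| := by rw [← Finset.sum_mul, mul_comm]

/-- ★ the reading constant: `cR39 b := coordBound · basisBound · |κ|` — a constant of the algebra `𝔸` and its basis only (uniform in the member).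
[cite: Balaban1985BackgroundPropagators, (3.48) p.398, dictionary] -/
def cR39 [FiniteDimensional ℝ 𝔸] (b : Module.Basis κ ℝ 𝔸) : ℝ := coordBound39 b * basisBound39 b * Fintype.card κ

/-- `0 ≤ cR39 b`. [cite: Balaban1985BackgroundPropagators, (3.48) p.398, bookkeeping] -/
theorem cR39_nonneg [FiniteDimensional ℝ 𝔸] (b : Module.Basis κ ℝ 𝔸) : 0 ≤ cR39 b :=
  mul_nonneg (mul_nonneg (norm_nonneg _) (Finset.sum_nonneg fun _ _ => norm_nonneg _)) (Nat.cast_nonneg _)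

/-- ★ **THE READING IS DOMINATED BY THE COORDINATE ENTRIES**: for `‖E‖ ≤ 1`,
`‖(O(δ_{s′} ⊗ E))(s)‖ ≤ coordBound · basisBound · Σ_c Σ_{c′} |entry (realify39 b O) (s, c) (s′, c′)|`. [cite: Balaban1985BackgroundPropagators, (3.48) p.398 (the kernel entry is read through a norm), dictionary] -/
theorem norm_apply_deltaY_le [FiniteDimensional ℝ 𝔸] [DecidableEq S] [DecidableEq κ] (b : Module.Basis κ ℝ 𝔸) (O : (S → 𝔸) →ₗ[ℂ] (S → 𝔸)) (s s' : S)
    {E : 𝔸} (hE : ‖E‖ ≤ 1) :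
    ‖O (deltaY s' E) s‖ ≤ coordBound39 b * basisBound39 b * ∑ c, ∑ c', |entry (realify39 b O) (s, c) (s', c')| := by
  have hdec : deltaY s' E = ∑ c', (b.repr E c') • deltaY (X := S) s' (b c') := by
    funext z
    rw [Finset.sum_apply]
    by_cases hz : z = s'
    · simp only [deltaY, hz, if_true, Pi.smul_apply]
      exact (b.sum_repr E).symm
    · simp [deltaY, hz]
  have hO : O (deltaY s' E) s = ∑ c', (b.repr E c') • O (deltaY s' (b c')) s := by
    rw [hdec]
    have : O (∑ c', (b.repr E c') • deltaY (X := S) s' (b c')) = ∑ c', (b.repr E c') • O (deltaY s' (b c')) := by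
      rw [map_sum]
      refine Finset.sum_congr rfl fun c' _ => ?_
      exact (O.restrictScalars ℝ).map_smul (b.repr E c') _
    rw [this, Finset.sum_apply]
    rfl
  have hcb : 0 ≤ coordBound39 b := norm_nonneg _
  have hbb : 0 ≤ basisBound39 b := Finset.sum_nonneg fun _ _ => norm_nonneg _
  rw [hO]
  calc ‖∑ c', (b.repr E c') • O (deltaY s' (b c')) s‖ ≤ ∑ c', ‖(b.repr E c') • O (deltaY s' (b c')) s‖ := norm_sum_le _ _
    _ = ∑ c', |b.repr E c'| * ‖O (deltaY s' (b c')) s‖ := by simp [norm_smul]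
    _ ≤ ∑ c', (coordBound39 b * 1) * (basisBound39 b * ∑ c, |entry (realify39 b O) (s, c) (s', c')|) := by
        refine Finset.sum_le_sum fun c' _ => mul_le_mul ?_ ?_ (norm_nonneg _) (mul_nonneg hcb zero_le_one)
        · exact (abs_repr_le b E c').trans (mul_le_mul_of_nonneg_left hE hcb)
        · rw [apply_deltaY_basis_eq_sum b O s s' c']
          exact norm_sum_smul_basis_le b _
    _ = coordBound39 b * basisBound39 b * ∑ c, ∑ c', |entry (realify39 b O) (s, c) (s', c')| := by
        rw [Finset.sum_comm, Finset.mul_sum]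
        simp [Finset.mul_sum, mul_assoc, mul_left_comm]

end Coords

/-! ## §2 The record's representatives: one index bond per carrier block -/

section Representatives

open B6SectADomainsV1 B6SectAOperatorsV1 B6KLevelCensusIndexV1 B6Ineq2142KLevelV1 B9GeoNormsKLevelV1

/-- **EVERY DOMAIN SEQUENCE HAS AN INDEX BOND** ([4] (2.3): `Λ_j = st_j(Ω_j^{(j)}) ∖ st_j(Ω_{j+1}^{(j)})`): at the top NON-EMPTY level `j₀`
(`Ω₀ = T ≠ ∅`, `Ω_j = ∅` beyond `k`) nothing is deep, so every bond issuing from `Ω_{j₀}^{(j₀)}` is an index bond.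
[cite: Balaban1984PropagatorsII, (2.1)–(2.3) p.224] -/
theorem bondIdx_nonempty {P : Params} (D : Domains P) : Nonempty (BondIdx D) := by
  classical
  let Q : ℕ → Prop := fun j => (D.Om j).Nonempty
  let j₀ := Nat.findGreatest Q D.k
  have hQ0 : Q 0 := by
    show (D.Om 0).Nonempty
    rw [D.Om_zero]
    exact Finset.univ_nonempty
  have hj₀ : Q j₀ := Nat.findGreatest_spec (P := Q) (Nat.zero_le D.k) hQ0
  have hle : j₀ ≤ D.k := Nat.findGreatest_le D.k
  have hnext : D.Om (j₀ + 1) = ∅ := by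
    by_cases h : j₀ + 1 ≤ D.k
    · have hnot : ¬ Q (j₀ + 1) := Nat.findGreatest_is_greatest (Nat.lt_succ_self _) h
      exact Finset.not_nonempty_iff_eq_empty.mp hnot
    · exact D.Om_eq_empty (by omega)
  obtain ⟨y, hy⟩ := hj₀
  have hdeep : ∀ z : Site P j₀, ¬ D.Deep j₀ z := fun z => by
    simp [Domains.Deep, hnext]
  refine ⟨⟨⟨⟨j₀, Nat.lt_succ_of_le hle⟩, ⟨y, ⟨0, P.hd⟩⟩⟩, ?_⟩⟩
  exact ⟨Or.inl hy, hdeep _, hdeep _⟩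

variable {d ℓ : ℕ} {hd : 1 ≤ d + 1} {hL : Odd (ℓ + 1) ∧ 1 < ℓ + 1} {b₀ b₁ : ℝ}

/-- **THE REPRESENTATIVE BOND OF A BLOCK of `𝔅`**: an index bond whose carrier block ([4] (2.45): `β c = B^j(base c)`) is the given block when there
is one (blocks outside the range of `β` — inner corners, `B9BetaRangeKLevelV1` — get an arbitrary bond). [cite: Balaban1984PropagatorsII, (2.3) p.224 + (2.45) p.231 + p.248 («sites replaced by bonds»)] -/
def rep39 (i : KIdx d ℓ hd hL b₀ b₁) (s : BlkY i) : IBondY i :=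
  if h : ∃ c : IBondY i, β i.hN i.D i.hk c = s then h.choose else Classical.choice (bondIdx_nonempty _)

/-- a block in the range of `β` is the carrier block of its representative. [cite: Balaban1984PropagatorsII, (2.45) p.231] -/
theorem beta_rep39 (i : KIdx d ℓ hd hL b₀ b₁) {s : BlkY i} (h : ∃ c : IBondY i, β i.hN i.D i.hk c = s) :
    β i.hN i.D i.hk (rep39 i s) = s := by
  rw [rep39, dif_pos h]
  exact h.choose_spec

/-- ★ **THE REPRESENTATIVE MAP OF THE GEOMETRY OF RECORD**: `π c :=` the representative bond of the carrier block of `c` — ONE index bond per carrier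
block. [cite: Balaban1984PropagatorsII, p.248 («sites replaced by bonds») + (2.45) p.231] -/
def repSite39 (i : KIdx d ℓ hd hL b₀ b₁) (c : IBondY i) : IBondY i := rep39 i (β i.hN i.D i.hk c)

/-- `β (π c) = β c`. [cite: Balaban1984PropagatorsII, (2.45) p.231] -/
theorem beta_repSite39 (i : KIdx d ℓ hd hL b₀ b₁) (c : IBondY i) : β i.hN i.D i.hk (repSite39 i c) = β i.hN i.D i.hk c :=
  beta_rep39 i ⟨c, rfl⟩

/-- **`π` PRESERVES THE DISTANCE** ([4] p. 231: *"d(x, x′) = d(y, y′) if x ∈ B^j(y), x′ ∈ B^{j′}(y′)"* — the geometry of record has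
`dist c c′ = d_T(β c, β c′)`). [cite: Balaban1984PropagatorsII, (2.45)–(2.46) p.231] -/
theorem dist_repSite39 (i : KIdx d ℓ hd hL b₀ b₁) (c c' : IBondY i) :
    (geo9K i).dist (repSite39 i c) (repSite39 i c') = (geo9K i).dist c c' := by
  show (B6Geom246MultiLevelTorus.geomT i.D).dist (β i.hN i.D i.hk _) (β i.hN i.D i.hk _) =
    (B6Geom246MultiLevelTorus.geomT i.D).dist (β i.hN i.D i.hk _) (β i.hN i.D i.hk _)
  rw [beta_repSite39, beta_repSite39]

/-- `π` preserves distances FROM a bond (the distance reads the carrier blocks). [cite: Balaban1984PropagatorsII, (2.45)–(2.46) p.231] -/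
theorem dist_repSite39_left (i : KIdx d ℓ hd hL b₀ b₁) (c z : IBondY i) :
    (geo9K i).dist (repSite39 i c) z = (geo9K i).dist c z := by
  show (B6Geom246MultiLevelTorus.geomT i.D).dist (β i.hN i.D i.hk _) (β i.hN i.D i.hk _) =
    (B6Geom246MultiLevelTorus.geomT i.D).dist (β i.hN i.D i.hk _) (β i.hN i.D i.hk _)
  rw [beta_repSite39]

/-- `π` preserves distances TO a bond. [cite: Balaban1984PropagatorsII, (2.45)–(2.46) p.231] -/
theorem dist_repSite39_right (i : KIdx d ℓ hd hL b₀ b₁) (z c : IBondY i) :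
    (geo9K i).dist z (repSite39 i c) = (geo9K i).dist z c := by
  show (B6Geom246MultiLevelTorus.geomT i.D).dist (β i.hN i.D i.hk _) (β i.hN i.D i.hk _) =
    (B6Geom246MultiLevelTorus.geomT i.D).dist (β i.hN i.D i.hk _) (β i.hN i.D i.hk _)
  rw [beta_repSite39]

/-- the level of an index bond is the level of its carrier block, hence `π`-invariant. [cite: Balaban1984PropagatorsII, (2.45) p.231] -/
theorem lvl_repSite39 (i : KIdx d ℓ hd hL b₀ b₁) (c : IBondY i) : lvl i.hN i.D i.hk (repSite39 i c) = lvl i.hN i.D i.hk c := by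
  have hk1 : 1 ≤ i.k := le_trans (by norm_num) i.hk2
  rw [← beta_level i.hN i.D i.hk hk1, ← beta_level i.hN i.D i.hk hk1, beta_repSite39]

/-- **`π` PRESERVES THE LENGTH `L^jη`** (the scale of a bond is the level of its carrier block). [cite: Balaban1984PropagatorsII, (2.1) p.224 + (2.45) p.231] -/
theorem len_repSite39 (i : KIdx d ℓ hd hL b₀ b₁) (c : IBondY i) : (geo9K i).len (repSite39 i c) = (geo9K i).len c := by
  rw [geo9K_len_kGeo, geo9K_len_kGeo, B6KLevelCensusIndexV1.len_eq, B6KLevelCensusIndexV1.len_eq, lvl_repSite39]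

/-- `π` preserves the pairing weight `(L^{j′}η)^d`. [cite: Balaban1985BackgroundPropagators, (3.48) p.398, bookkeeping] -/
theorem vol_repSite39 (i : KIdx d ℓ hd hL b₀ b₁) (dd : ℕ) (c : IBondY i) : vol (geo9K i) dd (repSite39 i c) = vol (geo9K i) dd c := by
  unfold vol
  rw [len_repSite39]

end Representatives

end

end Literature.MathematicalPhysics.QuantumFieldTheory.Balaban1983to89.B9Thm39ReadingCoords
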